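import Mathlib

/-!
# Harder–Narasimhan types of the evaluation cokernel in the cells (3;2,4) and (5;2,12), and the general divisibility

HONEST FRAMING. Lean index of the computation cell `pub-hsemireg` (W4 widening, lattice-first seat w4-lat-2,
gen 13; doc of record `widen/W4/lat2/code13/SIGMA-W4-CLOSED-w4lat2g13.md` §1 (symmetry lemma S1), §5c, §5d).
Companion of `EvaluationCokernelHNTypesW4.lean` (the W4 cell `(7;4,12)`). Elementary integer / `ZMod` arithmetic
only: no abelian surface, no sheaf, nothing Hodge-theoretic is formalised, and nothing in this file says HC, HC_CM or
HC_AV is proved. No `sorry`, no axiom beyond the standard three, no named fact, no `def`.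

CONTEXT (informal, not formalised). In a cell `(n; m, dm)` the translation group `G = q(K(N^m))` fixes the evaluation
cokernel `𝒬`, so every Harder–Narasimhan piece `F` of `𝒬` has `G ⊂ K(det F)`; with `c₁(F) = j ν̄` this says that
`n·j` annihilates `B̂[m]`, i.e. `m ∣ n j`, hence `m ∣ j` when `gcd(n, m) = 1` (the note's LEMMA S1; the W4 file has
the instance `(n, m) = (7, 4)`). With the slope window `m/n < μ̄(last piece) < μ̄(𝒬) < μ̄(first piece)` this leaves:
no type at all for `(3;2,4)` (`𝒬` of rank `2`, `c₁ = 4ν̄`) and the single type `(1,2; 4,2)` for `(5;2,12)` (`𝒬` of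
rank `3`, `c₁ = 6ν̄`) — note §5c / §5d; the W4 cell's four types are in the companion file.

WHAT IS PROVED HERE (kernel-checked).
* `dvd_of_mul_kills_zmod`: for coprime `n, m` (with `m > 0`), if `n j` acts as zero on `ZMod m` then `m ∣ j`.
* `two_dvd_of_three_mul_kills_zmod2`, `two_dvd_of_five_mul_kills_zmod2`: the instances for `(3;2,4)`, `(5;2,12)`.
* `no_hn_type_324`: rank `2`, `j₁ + j₂ = 4`, `2 ∣ j_i`, slopes `j₁ > 2 > j₂ > 2/3` — impossible.
* `hn_type_5212_two`, `hn_type_5212_three`: rank `3`, `Σ j = 6`, `2 ∣ j_i`, decreasing slopes, first `> 2`, last in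
  `(2/5, 2)`: two pieces force `(r; j) = (1,2; 4,2)`, three pieces are impossible.
* `closing_5212`: in type `(1,2;4,2)` the line subbundle forces `A ≥ 6`, incompatible with the certified `A = 0`.
-/

namespace Summit.Ventures.HSemireg.EvaluationCokernelHNTypesSmallCells

/-- General arithmetic core of the symmetry lemma: if `gcd(n, m) = 1` and multiplication by `n j` kills `ZMod m`
(i.e. `n j` annihilates `B̂[m] ≅ (ℤ/m)⁴`), then `m ∣ j`. -/
theorem dvd_of_mul_kills_zmod (n m : ℕ) (j : ℤ) (hcop : Nat.Coprime n m)
    (h : ∀ x : ZMod m, ((n * j : ℤ) : ZMod m) * x = 0) : (m : ℤ) ∣ j := by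
  have h1 : ((n * j : ℤ) : ZMod m) = 0 := by simpa using h 1
  have h2 : (m : ℤ) ∣ (n : ℤ) * j := (ZMod.intCast_zmod_eq_zero_iff_dvd (n * j) m).mp h1
  exact Int.dvd_of_dvd_mul_right_of_gcd_one h2 (by
    rw [Int.gcd_comm]; exact_mod_cast hcop)

/-- Instance for the cell `(3;2,4)`: `3 j` kills `ZMod 2` ⇒ `2 ∣ j`. -/
theorem two_dvd_of_three_mul_kills_zmod2 (j : ℤ) (h : ∀ x : ZMod 2, ((3 * j : ℤ) : ZMod 2) * x = 0) :
    (2 : ℤ) ∣ j := by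
  have := dvd_of_mul_kills_zmod 3 2 j (by norm_num) (by exact_mod_cast h)
  exact_mod_cast this

/-- Instance for the cell `(5;2,12)`: `5 j` kills `ZMod 2` ⇒ `2 ∣ j`. -/
theorem two_dvd_of_five_mul_kills_zmod2 (j : ℤ) (h : ∀ x : ZMod 2, ((5 * j : ℤ) : ZMod 2) * x = 0) :
    (2 : ℤ) ∣ j := by
  have := dvd_of_mul_kills_zmod 5 2 j (by norm_num) (by exact_mod_cast h)
  exact_mod_cast this

/-- Cell `(3;2,4)`: the cokernel has rank `2` and `c₁ = 4ν̄` (slope `2`), every quotient has slope `> 2/3`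
(`E = q_*N²` is stable of slope `2/3`), and every HN piece has even `c₁`. A Harder–Narasimhan filtration with two
rank-1 pieces would need `j₁ > 2 > j₂`, `3 j₂ > 2`, `j₁ + j₂ = 4`, `2 ∣ j₂` — impossible. So `𝒬` is semistable. -/
theorem no_hn_type_324 (j₁ j₂ : ℤ) (_hj : j₁ + j₂ = 4) (_hd₁ : (2 : ℤ) ∣ j₁) (hd₂ : (2 : ℤ) ∣ j₂)
    (_hfirst : j₁ > 2) (_hlast : j₂ < 2) (hstab : 3 * j₂ > 2) : False := by
  omega

/-- Cell `(5;2,12)`, two HN pieces: ranks `r₁ + r₂ = 3`, degrees `j₁ + j₂ = 6` in `2ℤ`, slopes `j₁/r₁ > 2 > j₂/r₂`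
and `j₂/r₂ > 2/5`: the only solution is `(r₁, r₂; j₁, j₂) = (1, 2; 4, 2)`. -/
theorem hn_type_5212_two (r₁ r₂ j₁ j₂ : ℤ) (hr₁ : 1 ≤ r₁) (hr₂ : 1 ≤ r₂) (hsum : r₁ + r₂ = 3)
    (hd₁ : (2 : ℤ) ∣ j₁) (hd₂ : (2 : ℤ) ∣ j₂) (hj : j₁ + j₂ = 6)
    (hfirst : j₁ > 2 * r₁) (hlast : j₂ < 2 * r₂) (hstab : 5 * j₂ > 2 * r₂) :
    r₁ = 1 ∧ r₂ = 2 ∧ j₁ = 4 ∧ j₂ = 2 := by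
  have hr₁' : r₁ ≤ 2 := by omega
  have hr₂' : r₂ ≤ 2 := by omega
  interval_cases r₁ <;> interval_cases r₂ <;> omega

/-- Cell `(5;2,12)`, three HN pieces (all of rank `1`): the last piece would need an even `j₃` with
`2/5 < j₃ < 2` — impossible. -/
theorem hn_type_5212_three (j₁ j₂ j₃ : ℤ) (_hj : j₁ + j₂ + j₃ = 6) (_hs₁₂ : j₁ > j₂) (_hs₂₃ : j₂ > j₃)
    (hd₃ : (2 : ℤ) ∣ j₃) (hlast : j₃ < 2) (hstab : 5 * j₃ > 2) : False := by
  omega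

/-- Cell `(5;2,12)`, the closing arithmetic: in type `(1,2;4,2)` the line subbundle of class `4ν̄` gives
`A = h⁰(𝒬 ⊗ N̄⁻³ ⊗ P′) ≥ h⁰(N̄ ⊗ P) = ν̄²/2 = 6`; the certified value is `A = 0`. -/
theorem closing_5212 (A : ℤ) (hA : A ≥ 12 / 2) (hcert : A ≤ 0) : False := by
  omega

/-- The Mukai vectors of the two cells are isotropic (`ν̄² = 4` resp. `12`): `(2, 4, 16)`: `4·4² = 2·2·16`;
`(3, 6, 72)`: `12·6² = 2·3·72`; and `(1, 6, 108)` for `(5;3,9)` (`ν̄² = 6`): `6·6² = 2·1·108`. -/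
theorem mukai_vectors_isotropic :
    (4 : ℤ) * 4 ^ 2 = 2 * 2 * 16 ∧ (12 : ℤ) * 6 ^ 2 = 2 * 3 * 72 ∧ (6 : ℤ) * 6 ^ 2 = 2 * 1 * 108 := by
  norm_num

end Summit.Ventures.HSemireg.EvaluationCokernelHNTypesSmallCells
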